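import Summits.BirchSwinnertonDyer.BirchSwinnertonDyer.Theorems.ByReductionTypeAtTwoP412KernelEulerBase
import Summits.BirchSwinnertonDyer.BirchSwinnertonDyer.Theorems.ByReductionTypeAtTwoP412KernelEulerStep
import Summits.BirchSwinnertonDyer.BirchSwinnertonDyer.Theorems.ByReductionTypeAtTwoMultTransportP49KernelTwistKernel
import Summits.BirchSwinnertonDyer.BirchSwinnertonDyer.Theorems.ByReductionTypeAtTwoMultTransportP49KernelAssembly
import Literature.NumberTheory.EllipticCurves.PrimaryTorsionContinuousSMulProofs
import HarnessLib

/-!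
# P412 in the kernel, VI — SPECIALISATION `T = γ − 1`: `𝒜[T] ≅ E[p^∞]` over `G_{ℚ,S}` and the corank count for the
# co-induced module `𝒜 = E[p^∞] ⊗ Λ^*`: `rank_Λ H⁰(𝒜)^∨ − rank_Λ H¹(𝒜)^∨ + rank_Λ H²(𝒜)^∨ ≤ −1`

Cell `bsd-2adic` (run/shared/lean/pub/bsd-2adic/), seat `bsd-2adic-t42` GEN 20 (pen RC-315 (b): discharge of the PRINT
binder P412 = `Greenberg1999.prop412_noFiniteSubmodule_H1Sigma_of_rank_one`). HONEST FRAMING: research route;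
THEOREMS ONLY (no `def`, no named fact, no instance, no `sorry`); nothing booked; BSD is not proved by any of this.
PARTITION: K4 PRINT binder P412 × all p — reduces-the-named-input-of; bears_on K4 19097
(`--supports stmt-BirchSwinnertonDyer-19097`).

## What (Greenberg LNM 1716 p. 114 «`corank_Λ H¹ = corank_Λ H² + δ` … derived from the fact that
## `Σ(−1)ⁱ corank_{ℤ_p} Hⁱ(F_Σ/F_n, E[p^∞]) = −δ pⁿ`», p. 115 «`𝒜[θ_s] ≅ … A_{−s}` as `Gal(F_Σ/F)`-modules», `s = 0`)

* §1 `HAddEquivOfContinuousAddEquiv_smul_of_smul` — the cohomology comparison along an equivariant `η : M₁ ≃ₜ+ M₂`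
  carries `r·` to `s·` whenever `η(r·x) = s·η(x)` (two coefficient rings; naturality of the comparison).
* §2 `exists_twistOne_continuousAddEquiv` — for `θ₁ = C(1)·T + C(0)` (`= T`): evaluation at `0` is an equivariant
  `𝒜[θ₁] ≃ₜ+ E[p^∞]` between the `Λ`-subrepresentation of `𝒜 = bigRep κ̄ ρ₀` and the model `ρ₀` (file LII at `u = 1`),
  carrying `f·` to `f(0)·`.
* §3 `finrank_torsionBy_characterModule_H_twistOne_eq` — hence
  `rank_{Λ/(θ₁)} Hⁱ(G_S, 𝒜[θ₁])^∨[θ₁] = rank_{ℤ_p} Hⁱ(G_S, E[p^∞])^∨` (`Λ/(θ₁) ≅ ℤ_p` by `f ↦ f(0)`).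
* §4 **`euler_characterModule_H_bigRep_le`** — STEP (`alternatingSum_finrank_characterModule_H_le` at `T = θ₁`) + §3 +
  BASE (`euler_characterModule_H_le`): `Σ_{i≤2}(−1)ⁱ rank_Λ Hⁱ(G_{ℚ,S}, 𝒜)^∨ ≤ −1`, GRANTED Tate I.5.1 and PT 17.13 (a)(b)
  for `ℚ` — the hypothesis `stub`-free form consumed by the P412 assembly.

References: [GreenbergLNM1716] §4 pp. 114–116; [Greenberg2006] §4 A p. 368; [MilneADT2006] I Thm. 5.1.
-/

set_option autoImplicit false
set_option linter.dupNamespace false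

noncomputable section

open scoped Classical
open CategoryTheory Limits

namespace Summit.BirchSwinnertonDyer.BirchSwinnertonDyer.Theorems.P412Kernel

open NumberField IsDedekindDomain Field WeierstrassCurve
  Literature.NumberTheory.EllipticCurves Literature.NumberTheory.EllipticCurves.BigRepModule
  Literature.NumberTheory.GaloisRepresentations Literature.NumberTheory.GaloisCohomology
  Literature.NumberTheory.IwasawaTheory.Greenberg2006 Literature.NumberTheory.IwasawaTheory.Greenberg2016
  _root_.TopRep _root_.ContRepresentation _root_.ContinuousCohomology _root_.Module Submodule
  Summit.BirchSwinnertonDyer.BirchSwinnertonDyer.Theorems.SignedBaseChangeAcDivCofree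

/-! ## §1. Semilinearity of the cohomology comparison -/

section Semilinear

variable {G : Type} [Group G] [TopologicalSpace G] [IsTopologicalGroup G]
  {A₁ : Type} [CommRing A₁] [TopologicalSpace A₁]
  {A₂ : Type} [CommRing A₂] [TopologicalSpace A₂]
  {M₁ : Type} [AddCommGroup M₁] [Module A₁ M₁] [TopologicalSpace M₁] [DiscreteTopology M₁] [ContinuousSMul A₁ M₁]
  {M₂ : Type} [AddCommGroup M₂] [Module A₂ M₂] [TopologicalSpace M₂] [DiscreteTopology M₂] [ContinuousSMul A₂ M₂]

/-- **The comparison `Hⁿ(G, M₁) ≃+ Hⁿ(G, M₂)` along an equivariant `η` carries `r·` to `s·` whenever `η(r·x) = s·η(x)`**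
(scalars act on `Hⁿ` through the coefficient endomorphisms, `cohomologyMap_eq_smul`; the comparison is natural,
`continuousCohomologyAddEquiv_map`). [cite: Greenberg2006, §4 A (proof of Props. 4.1/4.2, p. 368 L49–52)]
[cite: Brown1982CohomologyGroups, III.1 Example 3] -/
theorem HAddEquivOfContinuousAddEquiv_smul_of_smul (ρ₁ : ContinuousRep G A₁ M₁) (ρ₂ : ContinuousRep G A₂ M₂)
    (η : M₁ ≃ₜ+ M₂) (hη : ∀ (g : G) (x : M₁), η (ρ₁ g x) = ρ₂ g (η x)) (n : ℕ) (r : A₁) (s : A₂)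
    (hrs : ∀ x : M₁, η (r • x) = s • η x) (c : ρ₁.H n) :
    ContinuousRep.HAddEquivOfContinuousAddEquiv ρ₁ ρ₂ η hη n (r • c) =
      s • ContinuousRep.HAddEquivOfContinuousAddEquiv ρ₁ ρ₂ η hη n c := by
  let μ : ρ₁.toTopRep ⟶ ρ₁.toTopRep := TopRep.ofHom
    { toLinearMap := r • LinearMap.id
      cont := continuous_of_discreteTopology
      isIntertwining' := fun g => by ext m; simp }
  let μ' : ρ₂.toTopRep ⟶ ρ₂.toTopRep := TopRep.ofHom
    { toLinearMap := s • LinearMap.id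
      cont := continuous_of_discreteTopology
      isIntertwining' := fun g => by ext m; simp }
  have h1 : r • c = cohomologyMap μ n c := (cohomologyMap_eq_smul ρ₁ μ r (fun _ => rfl) n c).symm
  have h2 : ∀ c' : ρ₂.H n, s • c' = cohomologyMap μ' n c' :=
    fun c' => (cohomologyMap_eq_smul ρ₂ μ' s (fun _ => rfl) n c').symm
  rw [h1, h2]
  exact continuousCohomologyAddEquiv_map (X := ρ₁.toTopRep) (X' := ρ₂.toTopRep)
    (Y := ρ₁.toTopRep) (Y' := ρ₂.toTopRep) η hη η hη (ContinuousMonoidHom.id G) (resIdHom μ) (resIdHom μ')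
    (fun x => hrs x) n c

end Semilinear

/-! ## §2. `𝒜[θ₁] ≅ E[p^∞]` over `G_{K,S}` by evaluation at `0` -/

section TwistOne

variable {K : Type} [Field K] [NumberField K] {S : Set (HeightOneSpectrum (𝓞 K))} {p : ℕ} [Fact p.Prime]
  (W : WeierstrassCurve K) (κ : ZpExtension K p)
  [TopologicalSpace (IwasawaAlgebra p)]
  (ρ₀ : ContinuousRep (GaloisGroupUnramifiedOutside K S) ℤ_[p] (PrimaryTorsion W.geomPoints p))
  (hSp : ∀ v : HeightOneSpectrum (𝓞 K), ((p : ℕ) : 𝓞 K) ∈ v.asIdeal → v ∈ S)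

omit [Fact p.Prime] in
/-- `p ∣ 1 − 1`. [folklore] -/
theorem dvd_one_sub_one : (p : ℤ) ∣ (1 : ℤ) - 1 := by simp

omit [TopologicalSpace (IwasawaAlgebra p)] in
/-- `θ₁ = C(1)·T + C(1 − 1) = T`. [cite: GreenbergLNM1716, §4 p. 115 (θ_s = T − (κ^s(γ) − 1), s = 0)] -/
theorem twistOne_eq_X :
    (PowerSeries.C (((1 : ℤ) : ℤ_[p])) * PowerSeries.X + PowerSeries.C ((((1 : ℤ) : ℤ_[p])) - 1) :
      IwasawaAlgebra p) = PowerSeries.X := by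
  simp

/-- **`𝒜[θ₁] ≃ₜ+ E[p^∞]`, equivariant and `f ↦ f(0)`-semilinear** — evaluation at `0` on the `θ₁`-kernel of the
co-induced module (file LII: injective `eq_of_apply_zero_eq`, onto `exists_torsionBy_twist_apply_zero_eq`, intertwining
`bigRep_apply_zero_eq_pow_smul` with `u = 1`). [cite: GreenbergLNM1716, §4 p. 115 («𝒜[θ_s] ≅ A_{-s} as Gal(F_Σ/F)-modules»)] -/
theorem exists_twistOne_continuousAddEquiv :
    ∃ η : torsionBy (IwasawaAlgebra p) (BigRepModule ℤ_[p] p (PrimaryTorsion W.geomPoints p))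
          (PowerSeries.C (((1 : ℤ) : ℤ_[p])) * PowerSeries.X + PowerSeries.C ((((1 : ℤ) : ℤ_[p])) - 1) :
            IwasawaAlgebra p) ≃ₜ+ PrimaryTorsion W.geomPoints p,
      (∀ y, η y = (y : BigRepModule ℤ_[p] p (PrimaryTorsion W.geomPoints p)) 0) ∧
      (∀ (g : GaloisGroupUnramifiedOutside K S) (y),
        η (((bigRep (κ.liftUnramifiedOutside S hSp) ρ₀).subrepresentation _
          ((bigRep (κ.liftUnramifiedOutside S hSp) ρ₀).torsionBy_smul_le_comap _)) g y) = ρ₀ g (η y)) ∧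
      (∀ (f : IwasawaAlgebra p) (y), η (f • y) = PowerSeries.constantCoeff f • η y) := by
  set θ : IwasawaAlgebra p :=
    PowerSeries.C (((1 : ℤ) : ℤ_[p])) * PowerSeries.X + PowerSeries.C ((((1 : ℤ) : ℤ_[p])) - 1) with hθ
  have hθX : θ = PowerSeries.X := twistOne_eq_X
  have hmem : ∀ y : torsionBy (IwasawaAlgebra p) (BigRepModule ℤ_[p] p (PrimaryTorsion W.geomPoints p)) θ,
      θ • (y : BigRepModule ℤ_[p] p (PrimaryTorsion W.geomPoints p)) = 0 := fun y ↦
    (mem_torsionBy_iff θ _).mp y.2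
  -- evaluation at `0` as an additive equivalence
  let ev : torsionBy (IwasawaAlgebra p) (BigRepModule ℤ_[p] p (PrimaryTorsion W.geomPoints p)) θ →+
      PrimaryTorsion W.geomPoints p :=
    { toFun := fun y ↦ (y : BigRepModule ℤ_[p] p (PrimaryTorsion W.geomPoints p)) 0
      map_zero' := rfl
      map_add' := fun _ _ ↦ rfl }
  have hinj : Function.Injective ev := by
    intro y y' h
    exact Subtype.ext (P49Kernel.eq_of_apply_zero_eq (hmem y) (hmem y') h)
  have hsurj : Function.Surjective ev := by
    intro a
    have ha : p ^ a.level • a = 0 :=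
      PrimaryTorsion.ext (by rw [PrimaryTorsion.val_nsmul, a.level_spec, PrimaryTorsion.val_zero])
    obtain ⟨Φ, hΦ, -, h0⟩ := P49Kernel.exists_torsionBy_twist_apply_zero_eq (A := PrimaryTorsion W.geomPoints p)
      (u := 1) (u' := 1) (dvd_one_sub_one (p := p)) (k := a.level) (by simp) a ha
    exact ⟨⟨Φ, (mem_torsionBy_iff θ Φ).mpr hΦ⟩, h0⟩
  let η₀ : torsionBy (IwasawaAlgebra p) (BigRepModule ℤ_[p] p (PrimaryTorsion W.geomPoints p)) θ ≃+
      PrimaryTorsion W.geomPoints p := AddEquiv.ofBijective ev ⟨hinj, hsurj⟩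
  let η : torsionBy (IwasawaAlgebra p) (BigRepModule ℤ_[p] p (PrimaryTorsion W.geomPoints p)) θ ≃ₜ+
      PrimaryTorsion W.geomPoints p :=
    { η₀ with
      continuous_toFun := continuous_of_discreteTopology
      continuous_invFun := continuous_of_discreteTopology }
  refine ⟨η, fun _ ↦ rfl, fun g y ↦ ?_, fun f y ↦ ?_⟩
  · -- equivariance: `(g·Φ)(0) = 1^{…} • ρ₀(g) Φ(0)`
    change (bigRep (κ.liftUnramifiedOutside S hSp) ρ₀ g (y : BigRepModule ℤ_[p] p (PrimaryTorsion W.geomPoints p))) 0 =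
      ρ₀ g ((y : BigRepModule ℤ_[p] p (PrimaryTorsion W.geomPoints p)) 0)
    have hk : p ^ ((y : BigRepModule ℤ_[p] p (PrimaryTorsion W.geomPoints p)) 0).level •
        (y : BigRepModule ℤ_[p] p (PrimaryTorsion W.geomPoints p)) 0 = 0 :=
      PrimaryTorsion.ext (by rw [PrimaryTorsion.val_nsmul, PrimaryTorsion.level_spec, PrimaryTorsion.val_zero])
    rw [P49Kernel.bigRep_apply_zero_eq_pow_smul (κ := κ.liftUnramifiedOutside S hSp) (ρ := ρ₀)
      (dvd_one_sub_one (p := p)) (hmem y) hk g, Int.cast_one, one_pow, one_smul]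
  · -- semilinearity: `(f • Φ)(0) = f(0) • Φ(0)` for `Φ ∈ 𝒜[T]`
    change ((f • (y : BigRepModule ℤ_[p] p (PrimaryTorsion W.geomPoints p))) 0 : PrimaryTorsion W.geomPoints p) =
      PowerSeries.constantCoeff f • (y : BigRepModule ℤ_[p] p (PrimaryTorsion W.geomPoints p)) 0
    have hX : (PowerSeries.X : IwasawaAlgebra p) • (y : BigRepModule ℤ_[p] p (PrimaryTorsion W.geomPoints p)) = 0 := by
      rw [← hθX]; exact hmem y
    conv_lhs => rw [PowerSeries.eq_X_mul_shift_add_const f]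
    rw [add_smul, mul_comm, mul_smul, hX, smul_zero, zero_add, BigRepModule.C_smul, BigRepModule.smul_apply]

end TwistOne

/-! ## §3. `rank_{Λ/(θ₁)} Hⁱ(G_S, 𝒜[θ₁])^∨[θ₁] = rank_{ℤ_p} Hⁱ(G_S, E[p^∞])^∨` -/

section Transport

variable {K : Type} [Field K] [NumberField K] {S : Set (HeightOneSpectrum (𝓞 K))} {p : ℕ} [Fact p.Prime]
  (W : WeierstrassCurve K) (κ : ZpExtension K p)
  [TopologicalSpace (IwasawaAlgebra p)] [DiscreteTopology (IwasawaAlgebra p)]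
  [ContinuousSMul ℤ_[p] (PrimaryTorsion W.geomPoints p)]
  (ρ₀ : ContinuousRep (GaloisGroupUnramifiedOutside K S) ℤ_[p] (PrimaryTorsion W.geomPoints p))
  (hSp : ∀ v : HeightOneSpectrum (𝓞 K), ((p : ℕ) : 𝓞 K) ∈ v.asIdeal → v ∈ S)

omit [TopologicalSpace (IwasawaAlgebra p)] [DiscreteTopology (IwasawaAlgebra p)] in
/-- **The ring isomorphism `Λ/(θ₁) ≃+* ℤ_p`, `f ↦ f(0)`** (`θ₁ = T`; `ker(f ↦ f(0)) = (T)`).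
[cite: GreenbergLNM1716, §4 p. 115 (Λ/Λθ_s ≅ ℤ_p)] -/
theorem exists_ringEquiv_quotient_twistOne :
    ∃ e : (IwasawaAlgebra p ⧸ Ideal.span {(PowerSeries.C (((1 : ℤ) : ℤ_[p])) * PowerSeries.X +
        PowerSeries.C ((((1 : ℤ) : ℤ_[p])) - 1) : IwasawaAlgebra p)}) ≃+* ℤ_[p],
      ∀ f : IwasawaAlgebra p, e (Ideal.Quotient.mk _ f) = PowerSeries.constantCoeff f := by
  have hker : RingHom.ker (PowerSeries.constantCoeff (R := ℤ_[p])) =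
      Ideal.span {(PowerSeries.C (((1 : ℤ) : ℤ_[p])) * PowerSeries.X +
        PowerSeries.C ((((1 : ℤ) : ℤ_[p])) - 1) : IwasawaAlgebra p)} := by
    rw [twistOne_eq_X]
    ext φ
    rw [RingHom.mem_ker, Ideal.mem_span_singleton, PowerSeries.X_dvd_iff]
  have hsurj : Function.Surjective (PowerSeries.constantCoeff (R := ℤ_[p])) := fun a ↦
    ⟨PowerSeries.C a, PowerSeries.constantCoeff_C a⟩
  refine ⟨(Ideal.quotEquivOfEq hker.symm).trans (RingHom.quotientKerEquivOfSurjective hsurj), fun f ↦ ?_⟩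
  rfl

/-- **`rank_{Λ/(θ₁)} Hⁱ(G_{K,S}, 𝒜[θ₁])^∨[θ₁] = rank_{ℤ_p} Hⁱ(G_{K,S}, E[p^∞])^∨`** for every `i`: the cohomology
comparison along `𝒜[θ₁] ≃ E[p^∞]` (§2) is `f ↦ f(0)`-semilinear (§1), so `χ ↦ χ ∘ Φ⁻¹` is a semilinear additive
bijection of the duals along `Λ/(θ₁) ≃ ℤ_p` (`rank_eq_of_equiv_equiv`).
[cite: Greenberg2006, §4 A (proof of Props. 4.1/4.2, p. 368 L49–52)] [cite: GreenbergLNM1716, §4 pp. 114–115] -/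
theorem finrank_torsionBy_characterModule_H_twistOne_eq (i : ℕ)
    [Module.Finite (IwasawaAlgebra p ⧸ Ideal.span {(PowerSeries.C (((1 : ℤ) : ℤ_[p])) * PowerSeries.X +
        PowerSeries.C ((((1 : ℤ) : ℤ_[p])) - 1) : IwasawaAlgebra p)})
      (torsionBy (IwasawaAlgebra p) (CharacterModule
        ((((bigRep (κ.liftUnramifiedOutside S hSp) ρ₀).subrepresentation _
          ((bigRep (κ.liftUnramifiedOutside S hSp) ρ₀).torsionBy_smul_le_comap
            (PowerSeries.C (((1 : ℤ) : ℤ_[p])) * PowerSeries.X + PowerSeries.C ((((1 : ℤ) : ℤ_[p])) - 1) :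
              IwasawaAlgebra p)))).H i))
        (PowerSeries.C (((1 : ℤ) : ℤ_[p])) * PowerSeries.X + PowerSeries.C ((((1 : ℤ) : ℤ_[p])) - 1) :
          IwasawaAlgebra p))]
    [Module.Finite ℤ_[p] (CharacterModule (ρ₀.H i))] :
    Module.finrank (IwasawaAlgebra p ⧸ Ideal.span {(PowerSeries.C (((1 : ℤ) : ℤ_[p])) * PowerSeries.X +
        PowerSeries.C ((((1 : ℤ) : ℤ_[p])) - 1) : IwasawaAlgebra p)})
      (torsionBy (IwasawaAlgebra p) (CharacterModule
        ((((bigRep (κ.liftUnramifiedOutside S hSp) ρ₀).subrepresentation _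
          ((bigRep (κ.liftUnramifiedOutside S hSp) ρ₀).torsionBy_smul_le_comap
            (PowerSeries.C (((1 : ℤ) : ℤ_[p])) * PowerSeries.X + PowerSeries.C ((((1 : ℤ) : ℤ_[p])) - 1) :
              IwasawaAlgebra p)))).H i))
        (PowerSeries.C (((1 : ℤ) : ℤ_[p])) * PowerSeries.X + PowerSeries.C ((((1 : ℤ) : ℤ_[p])) - 1) :
          IwasawaAlgebra p)) =
      Module.finrank ℤ_[p] (CharacterModule (ρ₀.H i)) := by
  set θ : IwasawaAlgebra p :=
    PowerSeries.C (((1 : ℤ) : ℤ_[p])) * PowerSeries.X + PowerSeries.C ((((1 : ℤ) : ℤ_[p])) - 1) with hθ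
  set σA := (bigRep (κ.liftUnramifiedOutside S hSp) ρ₀).subrepresentation _
    ((bigRep (κ.liftUnramifiedOutside S hSp) ρ₀).torsionBy_smul_le_comap θ) with hσA
  obtain ⟨η, -, hηg, hηs⟩ := exists_twistOne_continuousAddEquiv W κ ρ₀ hSp
  obtain ⟨e, he⟩ := exists_ringEquiv_quotient_twistOne (p := p)
  -- the cohomology comparison and its semilinearity
  let Φ : σA.H i ≃+ ρ₀.H i := ContinuousRep.HAddEquivOfContinuousAddEquiv σA ρ₀ η hηg i
  have hΦ : ∀ (f : IwasawaAlgebra p) (c : σA.H i), Φ (f • c) = PowerSeries.constantCoeff f • Φ c := fun f c ↦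
    HAddEquivOfContinuousAddEquiv_smul_of_smul σA ρ₀ η hηg i f (PowerSeries.constantCoeff f) (hηs f) c
  have hΦ' : ∀ (f : IwasawaAlgebra p) (x : ρ₀.H i), Φ.symm (PowerSeries.constantCoeff f • x) = f • Φ.symm x :=
    fun f x ↦ by apply Φ.injective; rw [hΦ, AddEquiv.apply_symm_apply, AddEquiv.apply_symm_apply]
  -- every character of `Hⁱ(𝒜[θ])` is killed by `θ`
  have hθH : ∀ c : σA.H i, θ • c = 0 := fun c ↦ σA.smul_continuousCohomology_eq_zero θ
    (fun a ↦ Subtype.ext ((mem_torsionBy_iff θ _).mp a.2)) i c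
  -- the comparison of duals
  let j : torsionBy (IwasawaAlgebra p) (CharacterModule (σA.H i)) θ → CharacterModule (ρ₀.H i) :=
    fun χ ↦ ((χ : CharacterModule (σA.H i)) : σA.H i →+ AddCircle (1 : ℚ)).comp Φ.symm.toAddMonoidHom
  have hjbij : Function.Bijective j := by
    constructor
    · intro χ χ' h
      apply Subtype.ext
      ext c
      have := DFunLike.congr_fun h (Φ c)
      change (χ : CharacterModule (σA.H i)) (Φ.symm (Φ c)) = (χ' : CharacterModule (σA.H i)) (Φ.symm (Φ c)) at this
      rwa [AddEquiv.symm_apply_apply] at this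
    · intro ψ
      refine ⟨⟨(ψ : ρ₀.H i →+ AddCircle (1 : ℚ)).comp Φ.toAddMonoidHom, (mem_torsionBy_iff θ _).mpr ?_⟩, ?_⟩
      · ext c
        rw [CharacterModule.smul_apply, hθH, map_zero]
        rfl
      · ext x
        change ψ (Φ (Φ.symm x)) = ψ x
        rw [AddEquiv.apply_symm_apply]
  let J : torsionBy (IwasawaAlgebra p) (CharacterModule (σA.H i)) θ ≃+ CharacterModule (ρ₀.H i) :=
    AddEquiv.ofBijective (AddMonoidHom.mk' j (fun _ _ ↦ rfl)) hjbij
  have hrank := rank_eq_of_equiv_equiv (R := IwasawaAlgebra p ⧸ Ideal.span {θ}) (R' := ℤ_[p]) e J e.bijective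
    (fun r χ ↦ by
      obtain ⟨f, rfl⟩ := Ideal.Quotient.mk_surjective r
      ext x
      change ((f • (χ : CharacterModule (σA.H i))) : CharacterModule (σA.H i)) (Φ.symm x) =
        (χ : CharacterModule (σA.H i)) (Φ.symm (e (Ideal.Quotient.mk _ f) • x))
      rw [CharacterModule.smul_apply, he, hΦ'])
  have := congrArg Cardinal.toNat hrank
  simpa [Module.finrank] using this

end Transport

/-! ## §4. The corank count for `𝒜 = E[p^∞] ⊗ Λ^*` over `ℚ` -/

section Euler

variable {p : ℕ} [Fact p.Prime]

/-- **`rank_Λ H⁰(G_{ℚ,S}, 𝒜)^∨ − rank_Λ H¹(G_{ℚ,S}, 𝒜)^∨ + rank_Λ H²(G_{ℚ,S}, 𝒜)^∨ ≤ −1`** for the co-induced module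
`𝒜 = E[p^∞] ⊗ Λ^*(κ̄⁻¹)` (`bigRep`) of ANY continuous `ℤ_p`-model `ρ₀` of `E[p^∞]` over `G_{ℚ,S}` with `ρ₀(σ̄)P = σP`
(`S ⊇ {v ∣ p}` finite), GRANTED Tate I.5.1 and Poitou–Tate 17.13 (a)(b) for `ℚ` — Greenberg's
«`corank_Λ H¹ ≥ corank_Λ H² + δ`» half (LNM 1716 p. 114; with `corank_Λ H⁰ ≥ 0`): STEP at `T = θ₁`
(`alternatingSum_finrank_characterModule_H_le`), the transport of §3, and the BASE `euler_characterModule_H_le`.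
[cite: GreenbergLNM1716, §4 pp. 114–115] [cite: Greenberg2006, §4 A p. 368] [cite: MilneADT2006, I Thm. 5.1] -/
theorem euler_characterModule_H_bigRep_le
    (hPTb : poitouTate_shaRestricted_tateDual ℚ) (hPTa : poitouTate_restricted_three_le ℚ)
    (hTate : tateGlobalEulerPoincareCharacteristic ℚ)
    (W : WeierstrassCurve ℚ) [W.IsElliptic] (κ : ZpExtension ℚ p)
    {S : Set (HeightOneSpectrum (𝓞 ℚ))} (hS : S.Finite)
    (hSp : ∀ v : HeightOneSpectrum (𝓞 ℚ), ((p : ℕ) : 𝓞 ℚ) ∈ v.asIdeal → v ∈ S)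
    [TopologicalSpace (IwasawaAlgebra p)] [DiscreteTopology (IwasawaAlgebra p)] [IsTopologicalRing (IwasawaAlgebra p)]
    (ρ₀ : ContinuousRep (GaloisGroupUnramifiedOutside ℚ S) ℤ_[p] (PrimaryTorsion W.geomPoints p))
    (hρ₀ : ∀ (σ : absoluteGaloisGroup ℚ) (P : PrimaryTorsion W.geomPoints p),
      ρ₀ (toUnramifiedQuot ℚ S σ) P = σ • P)
    [Module.Finite (IwasawaAlgebra p) (CharacterModule ((bigRep (κ.liftUnramifiedOutside S hSp) ρ₀).H 0))]
    [Module.Finite (IwasawaAlgebra p) (CharacterModule ((bigRep (κ.liftUnramifiedOutside S hSp) ρ₀).H 1))]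
    [Module.Finite (IwasawaAlgebra p) (CharacterModule ((bigRep (κ.liftUnramifiedOutside S hSp) ρ₀).H 2))] :
    (Module.finrank (IwasawaAlgebra p) (CharacterModule ((bigRep (κ.liftUnramifiedOutside S hSp) ρ₀).H 0)) : ℤ) -
        Module.finrank (IwasawaAlgebra p) (CharacterModule ((bigRep (κ.liftUnramifiedOutside S hSp) ρ₀).H 1)) +
        Module.finrank (IwasawaAlgebra p) (CharacterModule ((bigRep (κ.liftUnramifiedOutside S hSp) ρ₀).H 2)) ≤ -1 := by
  haveI : ContinuousSMul ℤ_[p] (PrimaryTorsion W.geomPoints p) := PrimaryTorsion.continuousSMul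
  set θ : IwasawaAlgebra p :=
    PowerSeries.C (((1 : ℤ) : ℤ_[p])) * PowerSeries.X + PowerSeries.C ((((1 : ℤ) : ℤ_[p])) - 1) with hθ
  have hθX : θ = PowerSeries.X := twistOne_eq_X
  have hθ0 : θ ≠ 0 := by rw [hθX]; exact PowerSeries.X_ne_zero
  have hθprime : (Ideal.span {θ}).IsPrime := by rw [hθX]; exact PowerSeries.span_X_isPrime
  let 𝒜 := bigRep (κ.liftUnramifiedOutside S hSp) ρ₀
  let σA := 𝒜.subrepresentation (torsionBy (IwasawaAlgebra p) _ θ) (𝒜.torsionBy_smul_le_comap θ)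
  -- `0 → 𝒜[θ] → 𝒜 →θ 𝒜 → 0`
  obtain ⟨ι, μ, hSES, hμ⟩ := exists_isSES_torsionBy_smul 𝒜 θ
    (P49Kernel.twist_smul_surjective p W (dvd_one_sub_one (p := p)))
  have hA : ∀ a : torsionBy (IwasawaAlgebra p) (BigRepModule ℤ_[p] p (PrimaryTorsion W.geomPoints p)) θ,
      θ • a = 0 := fun a ↦ Subtype.ext ((mem_torsionBy_iff θ _).mp a.2)
  -- finite generation of all duals (Greenberg 2006 Prop. 3.2 from Poitou–Tate)
  obtain ⟨e⟩ := P49Kernel.nonempty_ringEquiv_mvPowerSeries_fin_one p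
  have hcof := (prop32_of_poitouTate_at hPTb hPTa _ hS hSp e 𝒜 (P49Kernel.isCofinitelyGenerated_bigRepModule p W)).1
  have hcofA := (prop32_of_poitouTate_at hPTb hPTa _ hS hSp e σA
    ((P49Kernel.isCofinitelyGenerated_bigRepModule p W).submodule _)).1
  have hfin : ∀ n, Module.Finite (IwasawaAlgebra p) (CharacterModule (𝒜.H n)) := fun n ↦
    isCofinitelyGenerated_iff_module_finite_characterModule.mp (hcof n)
  have hfinA : ∀ n, Module.Finite (IwasawaAlgebra p) (CharacterModule (σA.H n)) := fun n ↦
    isCofinitelyGenerated_iff_module_finite_characterModule.mp (hcofA n)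
  let e0 : ℤ_[p] ≃+* MvPowerSeries (Fin 0) ℤ_[p] := (NearlyOrdinaryPresentationCA.mvPowerSeriesFinZeroEquiv ℤ_[p]).symm
  have hcof0 := (prop32_of_poitouTate_at hPTb hPTa _ hS hSp e0 ρ₀
    (IsCofree.isCofinitelyGenerated (isCofree_primaryTorsion W p))).1
  haveI h0 : Module.Finite ℤ_[p] (CharacterModule (ρ₀.H 0)) :=
    isCofinitelyGenerated_iff_module_finite_characterModule.mp (hcof0 0)
  haveI h1 : Module.Finite ℤ_[p] (CharacterModule (ρ₀.H 1)) :=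
    isCofinitelyGenerated_iff_module_finite_characterModule.mp (hcof0 1)
  haveI h2 : Module.Finite ℤ_[p] (CharacterModule (ρ₀.H 2)) :=
    isCofinitelyGenerated_iff_module_finite_characterModule.mp (hcof0 2)
  have hfinT : ∀ n, Module.Finite (IwasawaAlgebra p ⧸ Ideal.span {θ})
      (torsionBy (IwasawaAlgebra p) (CharacterModule (σA.H n)) θ) := fun n ↦ by
    haveI := hfinA n
    haveI : Module.Finite (IwasawaAlgebra p) (torsionBy (IwasawaAlgebra p) (CharacterModule (σA.H n)) θ) :=
      Module.Finite.of_injective _ (torsionBy (IwasawaAlgebra p) (CharacterModule (σA.H n)) θ).injective_subtype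
    exact Module.Finite.of_restrictScalars_finite (IwasawaAlgebra p) _ _
  haveI := hfinT 0
  haveI := hfinT 1
  haveI := hfinT 2
  -- STEP, transport, BASE
  have hstep := alternatingSum_finrank_characterModule_H_le hθ0 hθprime σA 𝒜 hSES hμ hA hfin hfinA
  have ht0 := finrank_torsionBy_characterModule_H_twistOne_eq W κ ρ₀ hSp 0
  have ht1 := finrank_torsionBy_characterModule_H_twistOne_eq W κ ρ₀ hSp 1
  have ht2 := finrank_torsionBy_characterModule_H_twistOne_eq W κ ρ₀ hSp 2
  have hbase := euler_characterModule_H_le W ρ₀ hPTb hPTa hTate hS hSp hρ₀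
  rw [ht0, ht1, ht2] at hstep
  exact le_trans hstep hbase

end Euler

end Summit.BirchSwinnertonDyer.BirchSwinnertonDyer.Theorems.P412Kernel

end
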